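import Summits.NavierStokesRegularity.NavierStokesRegularity.Theses.HardyPointSink
import Literature.Analysis.FluidPDE.NSKatoToClayHolds

/-!
# Route HardyPointSink — `Assembly2` (item stmt-NavierStokesRegularity-7985)

Pure logic plus one PROVED tree fact: the route statements of `HardyPointSink`, in the antecedent
order

  `HardyEnergyBound → NoHardyTypeIAncient → HardyTypeIExtraction → ABForwardHardy →
   NavierStokesRegularity`,

imply Clay (A). This is the route's deciding theorem
`Summit.NavierStokesRegularity.NavierStokesRegularity.Theses.HardyPointSink.closes` restricted to
the four hypotheses it actually uses; the proof below is self-contained (it does not invoke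
`closes`), so that it depends only on the item definitions and on the proved Literature fact
`Literature.Analysis.FluidPDE.clay_solution_of_hasGlobalKatoSolution_holds`
(`NSKatoToClayHolds.lean`; Kato 1984 Thm. 4 / von Wahl, Lemarié-Rieusset 2016 Prop. 12.3).

Argument (exactly as in route MarginalTypeI's `closes`). Fix `ν > 0` and a Clay datum `u₀`
(smooth, divergence free, rapidly decaying). Either `HasGlobalKatoSolution ν u₀` — then the proved
fact gives the jointly smooth bounded-energy solution `(u, p)` asked for by
`NavierStokesRegularity` — or not; in the latter case `HardyTypeIExtraction`, fed with the local
Hardy bound supplied by `HardyEnergyBound` for every Kato solution from `u₀`, produces a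
Hardy-bounded local Type-I singular point, `ABForwardHardy` turns it into a Hardy-bounded Type-I
mild bounded ancient witness, and `NoHardyTypeIAncient` says no such witness exists:
contradiction. Nothing here is new mathematics; the open content lives in the cruxes.

Repair 2026-08-16: the route file stopped declaring `Assembly2` (gate lint autofix
`route.multi-assembly`, 2026-08-16T14:43:07Z: duplicate assembly variants dropped, `Assembly` kept, the
proved record of stmt-7985 unchanged), so the constant is re-declared below in the route namespace,
with the item's ledger signature verbatim, solely so that its proved record
`hardyPointSink_assembly2_proof` keeps elaborating unchanged (same device as
`Theorems/CoherentStatesAssembly2.lean` of AnomalousDissipation).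
-/

namespace Summit.NavierStokesRegularity.NavierStokesRegularity.Theses.HardyPointSink

/-- The legacy assembly variant `Assembly2` of route HardyPointSink (item
stmt-NavierStokesRegularity-7985), ledger signature verbatim:
`HardyEnergyBound → NoHardyTypeIAncient → HardyTypeIExtraction → ABForwardHardy →
NavierStokesRegularity` over the route's surviving item declarations and the root-level summit
statement. The route file stopped declaring it on 2026-08-16 (multi-assembly autofix), so it is
re-declared here, unchanged, only to keep the proved record below elaborating (a definition, not a
cited fact). -/
def Assembly2 : Prop :=
  HardyEnergyBound → NoHardyTypeIAncient → HardyTypeIExtraction → ABForwardHardy →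
    _root_.NavierStokesRegularity

end Summit.NavierStokesRegularity.NavierStokesRegularity.Theses.HardyPointSink

namespace Summit.NavierStokesRegularity.NavierStokesRegularity.Theorems

open Summit.NavierStokesRegularity.NavierStokesRegularity.Theses.HardyPointSink

/-- **Assembly2** (item stmt-NavierStokesRegularity-7985, route HardyPointSink):
`HardyEnergyBound → NoHardyTypeIAncient → HardyTypeIExtraction → ABForwardHardy →
NavierStokesRegularity` — pure logic over the Kato dichotomy: for a Clay datum either a global
Kato solution exists (then `clay_solution_of_hasGlobalKatoSolution_holds` gives the Clay
solution), or `HardyTypeIExtraction` (fed by `HardyEnergyBound`) and `ABForwardHardy` produce the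
Hardy-bounded Type-I ancient witness that `NoHardyTypeIAncient` forbids. [folklore] -/
theorem hardyPointSink_assembly2_proof :
    Summit.NavierStokesRegularity.NavierStokesRegularity.Theses.HardyPointSink.Assembly2 := by
  unfold Assembly2
  intro hE hN hX hAB
  show Literature.NS.NavierStokesExistenceSmoothR3
  intro ν hν u₀ hsm hdiv hdec
  by_cases hK : Literature.Analysis.FluidPDE.HasGlobalKatoSolution ν u₀
  · exact Literature.Analysis.FluidPDE.clay_solution_of_hasGlobalKatoSolution_holds ν hν u₀ hsm
      hdiv hdec hK
  · exact absurd (hAB (hX ν hν u₀ hsm hdiv hdec hK (hE ν hν u₀ hsm hdiv hdec))) hN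

end Summit.NavierStokesRegularity.NavierStokesRegularity.Theorems
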